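import Summits.AtomisticToContinuum.FouriersLaw.Theses.OddSectorIrreversibility
import Summits.AtomisticToContinuum.FouriersLaw.Theorems.OddSectorIrreversibilityConeScaleCorrectorStubHorizonCorrectorMemLp
import Literature.MathematicalPhysics.KineticTheory.OddSectorLocalityHypothesis

/-!
# Strategist sketch for crux `ConeScaleCorrector` (E1, stmt-AtomisticToContinuum-14069) — STRATEGY-CENSUS companion

Wall-breaker seat `cstrat-stmt-AtomisticToContinuum-14069-p1` (2026-08-17). This file TYPES the statements the
census `STRATEGY-CENSUS.md` discusses under `## Strengthen` / `## Decomposition` / `## Transfer`, so that the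
human ruling on `no-strategy-short-of-summit` has elaborating objects in hand, and PROVES the one new glued split
found this session (D7: E1 ⟸ `ForecastArea` ∧ `ForecastCorrelationTime`), sorry-free.

Notation: `P_t = (pinnedChain ω₂ lam β γ).transitionKernel N T T t` (equilibrium OPEN kernels), `J = J_tot`,
`A_N(t) = ‖P_tJ‖²_{L²(μ_T)}` (`OddSectorLocality.forecastNormSq`), `u_τ = ∫₀^τ P_tJ dt` (`horizonCorrector`),
`Z = ∫ e^{-H/T}` (`Zmass`), `μ_T = e^{-H/T} dq dp` (`OddSectorLocality.gibbsWeight`).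

* §0 vocabulary (definitionally the crux's expressions);
* §1 the census statements as `Prop`s: (A1) `ForecastArea`, (A3) `ForecastCorrelationTime`,
  (A2) `ForecastDecorrelation` (pointwise Schur form — the census shows it implies bounded response),
  (MT) `MinkowskiMemory` (gives only the cubic bound), (A1h) `ForecastAreaHarmonic` (the provable calibration);
* §2 glue lemmas (Fatou step, re-proved here so that no `sorry` enters the closure);
* §3 `coneScaleCorrector_of_area_ratio : ForecastArea → ForecastCorrelationTime → ConeScaleCorrector` — PROVED
  (the route decl by name). NOT registered as a line: see the census for why neither hypothesis has a supplier
  and why `ForecastCorrelationTime` ⟺ E1 modulo `ForecastArea` in every known transport class.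
-/

noncomputable section

namespace Summit.AtomisticToContinuum.FouriersLaw.Cruxes.ConeScaleCorrector.Strategist

open MeasureTheory Filter Set Topology
open scoped ENNReal NNReal BigOperators
open Literature.MathematicalPhysics.KineticTheory.HeatConduction
open Literature.MathematicalPhysics.KineticTheory.OddSectorLocality
open Summit.AtomisticToContinuum.FouriersLaw.Theses.OddSectorIrreversibility (ConeScaleCorrector)

/-! ## §0 Vocabulary -/

section Objects

variable (ω₂ lam β γ T : ℝ) (N : ℕ)

/-- `Z = ∫ e^{-H_N/T} dq dp` (the crux's right-hand normalisation). -/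
def Zmass : ℝ :=
  ∫ x : PhaseSpace N, Real.exp (-((pinnedChain ω₂ lam β γ).hamiltonian N x) / T)

/-- `u_S(x) = ∫₀^S (P_tJ)(x) dt` — verbatim the crux's integrand. -/
def horizonCorrector (S : ℝ) (x : PhaseSpace N) : ℝ :=
  ∫ t in Set.Ioc (0 : ℝ) S, currentForecast ω₂ lam β γ T N t x

/-- The FORECAST AREA up to horizon `τ`: `𝒜_N(τ) = ∫₀^τ A_N(t) dt = ∫₀^τ ‖P_tJ‖²_{L²(μ_T)} dt`
(replica reading: the time-integrated two-replica current overlap `∫₀^τ E[J(X_t)J(X'_t)] dt`;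
dissipation reading: `𝒜_N(τ) = τ‖J‖² − 2∫₀^τ (τ−s) ℰ_tap(P_sJ) ds`, `ℰ_tap(f) = γT Σ_b ‖∂_{p_b}f‖²`). -/
def forecastArea (τ : ℝ) : ℝ :=
  ∫ t in Set.Ioc (0 : ℝ) τ, forecastNormSq ω₂ lam β γ T N t

end Objects

/-! ## §1 The census statements -/

/-- **(A1) `ForecastArea` — the current forecast has memory AREA `O(N²·Z)`** (census §Strengthen (v), §Decomposition D7).
`∃ C(T) ∀ N ∀ τ ≥ 0: ∫₀^τ ‖P_tJ_tot‖²_{L²(μ_T)} dt ≤ C·N²·Z`. Equivalently the mean TAP-DISSIPATION TIME of the current's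
`L²`-mass is `≤ C'·N` (`∫₀^∞ A_N = 2∫₀^∞ s·ℰ_tap(P_sJ) ds`, `∫₀^∞ ℰ_tap(P_sJ) ds = ‖J‖²/2 ≍ N·Z`). CLASS-BLIND: true for the
harmonic chain (phonon exit, `A_N(t) ≈ ‖J‖²(N/t)³` for `t ≳ N`) and for the chaotic chain (butterfly fronts,
`∫A_N ≈ ‖J‖²·N/(4v_B)`); fails only under sub-ballistic scrambling with no ballistic exit, or super-Boltzmann
long-lived oscillatory local modes (breathers with lifetime `≫ e^{E/T}`). Does NOT imply E1 (oscillating forecasts)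
nor bounded response. No supplier in tree or print for `lam, β > 0`. -/
def ForecastArea : Prop :=
  ∀ ω₂ lam β γ : ℝ, 0 < ω₂ → 0 < lam → 0 < β → 0 < γ → ∀ T : ℝ, 0 < T → ∃ C : ℝ,
    ∀ (N : ℕ) (τ : ℝ), 0 ≤ τ →
      ∫ t in Set.Ioc (0 : ℝ) τ, forecastNormSq ω₂ lam β γ T N t
        ≤ C * (N : ℝ) ^ 2 *
          ∫ x : PhaseSpace N, Real.exp (-((pinnedChain ω₂ lam β γ).hamiltonian N x) / T)

/-- **(A3) `ForecastCorrelationTime` — the forecast CURVE has an `O(1)` correlation time, GLOBAL form**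
(census §Decomposition D7). `∃ R(T) ∀ N ∀ τ ≥ 0: ‖u_τ‖²_{L²(μ_T)} = ∫₀^τ∫₀^τ ⟨P_sJ, P_tJ⟩ ds dt ≤ R · ∫₀^τ ‖P_tJ‖² dt`:
the off-diagonal mass of the positive-definite forecast Gram kernel `G(s,t) = ⟨P_sJ,P_tJ⟩_{μ_T}` is at most `R`
times its trace. Heuristic value `R ≈ 2 t_c ≈ σ²/⟨j²⟩` (chaotic class; from the item's numerics at (1,1,0.1,1),
T = 8: `R ≈ B(∞)/∫A_N ≈ 52/(11.5·0.8) ≈ 5.7`, `t_c ≈ 2–3`); FALSE for the harmonic chain (ratio `≍ N`: coherent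
phonons). Not implied by E1 (pure ratio, no slack) and does not imply E1 or bounded response alone. The POINTWISE
(Schur) form `ForecastDecorrelation` below implies it AND implies bounded response (census); this global form is the
only decorrelation factor of E1 found that does not contain `HasBoundedResponse` — and no proof technique reaches a
global ratio without passing through the pointwise one. ⟺ E1 modulo (A1) in every known class. -/
def ForecastCorrelationTime : Prop :=
  ∀ ω₂ lam β γ : ℝ, 0 < ω₂ → 0 < lam → 0 < β → 0 < γ → ∀ T : ℝ, 0 < T → ∃ R : ℝ,
    ∀ (N : ℕ) (τ : ℝ), 0 ≤ τ →
      ∫ x, (∫ t in Set.Ioc (0 : ℝ) τ, currentForecast ω₂ lam β γ T N t x) ^ 2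
          ∂(gibbsWeight ω₂ lam β γ T N)
        ≤ R * ∫ t in Set.Ioc (0 : ℝ) τ, forecastNormSq ω₂ lam β γ T N t

/-- **(A2) `ForecastDecorrelation` — POINTWISE (Schur-test) decorrelation of the forecast curve** (census
§Decomposition, "the KuboAbel obstruction"). `∃ ρ ≥ 0` with `∫₀^∞ ρ ≤ R` such that for all `N`, `0 ≤ s ≤ t`:
`⟨P_sJ, P_tJ⟩_{μ_T} ≤ ρ(t − s) · A_N(s)`. With (A1) it gives E1 by Fubini (`‖u‖² ≤ 2R∫A_N`). BUT at `s = 0` it reads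
`⟨J, P_rJ⟩ ≤ ρ(r)‖J‖²`, hence `⟨J, u⟩_{μ_T} = ∫₀^∞⟨J,P_rJ⟩dr ≤ R‖J‖² ≤ R·K·N·Z`, and `⟨J,u⟩_{μ_T} = (N−1)T²D_N·Z`
(Green–Kubo conjunct of `CorrectorTheory` = `KuboAbelIdentity`), so `D_N ≤ 2RK/T²`: HALF OF FOURIER'S LAW
(`HasBoundedResponse` at equilibrium). Recorded, not proposed. -/
def ForecastDecorrelation : Prop :=
  ∀ ω₂ lam β γ : ℝ, 0 < ω₂ → 0 < lam → 0 < β → 0 < γ → ∀ T : ℝ, 0 < T → ∃ (ρ : ℝ → ℝ) (R : ℝ),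
    (∀ r, 0 ≤ ρ r) ∧ IntegrableOn ρ (Set.Ici 0) ∧ ∫ r in Set.Ici (0 : ℝ), ρ r ≤ R ∧
    ∀ (N : ℕ) (s t : ℝ), 0 ≤ s → s ≤ t →
      ∫ x, currentForecast ω₂ lam β γ T N s x * currentForecast ω₂ lam β γ T N t x
          ∂(gibbsWeight ω₂ lam β γ T N)
        ≤ ρ (t - s) * forecastNormSq ω₂ lam β γ T N s

/-- **(MT) `MinkowskiMemory` — Minkowski-in-time memory bound** (census §Strengthen (vii) / §Transfer (c)):
`∃ C ∀ N: ∫₀^∞ √A_N(t) dt ≤ C·N·√(N·Z)` (`= C·N·‖J‖`-scale). Class-blind (harmonic: `∫√A ≈ ‖J‖·3N`), but by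
Minkowski (`‖u‖ ≤ ∫‖P_tJ‖`, landed `stub_minkowskiInTime`) it yields only the CUBIC bound `‖u‖² ≤ C²N³Z` — the
weakening consumed on route (K) (stmt-9121, evidence note p124332), not E1's `N²`; and it is EXPOSED to long-lived
oscillatory forecasts (breathers), which E1 is not. Typed on finite horizons to keep the Bochner integral honest. -/
def MinkowskiMemory : Prop :=
  ∀ ω₂ lam β γ : ℝ, 0 < ω₂ → 0 < lam → 0 < β → 0 < γ → ∀ T : ℝ, 0 < T → ∃ C : ℝ,
    ∀ (N : ℕ) (τ : ℝ), 0 ≤ τ →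
      ∫ t in Set.Ioc (0 : ℝ) τ, Real.sqrt (forecastNormSq ω₂ lam β γ T N t)
        ≤ C * (N : ℝ) * Real.sqrt ((N : ℝ) *
          ∫ x : PhaseSpace N, Real.exp (-((pinnedChain ω₂ lam β γ).hamiltonian N x) / T))

/-- **(A1h) `ForecastAreaHarmonic` — the provable CALIBRATION of (A1)** (census §Transfer (c)): the same area
bound on the Rieder–Lebowitz–Lieb chain `lam = β = 0` (where E1 is FALSE with exponent 3, Disproof §2b, but the
forecast area is still `≍ N²·Z`: phonons exit in time `≍ N/v_g` and carry current `∝ v_g²`). Finite-dimensional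
Gaussian spectral theory (`P_tJ` linear in `(q,p)`, `∫₀^∞ A_N = c₀ᵀ X c₀` with `X` a Lyapunov-equation solution for
the RLL drift matrix); an honest support-sized target for a prover, not a stub of E1. -/
def ForecastAreaHarmonic : Prop :=
  ∀ ω₂ γ : ℝ, 0 < ω₂ → 0 < γ → ∀ T : ℝ, 0 < T → ∃ C : ℝ,
    ∀ (N : ℕ) (τ : ℝ), 0 ≤ τ →
      ∫ t in Set.Ioc (0 : ℝ) τ, forecastNormSq ω₂ 0 0 γ T N t
        ≤ C * (N : ℝ) ^ 2 *
          ∫ x : PhaseSpace N, Real.exp (-((pinnedChain ω₂ 0 0 γ).hamiltonian N x) / T)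

/-! ## §2 Glue lemmas (proved) -/

section LTwo

variable {X : Type*} [MeasurableSpace X] {μ : Measure X}

/-- `‖f‖_{L²(μ)} = ofReal √(∫ f² dμ)` for real `f ∈ L²`. -/
theorem eLpNorm_two_eq_sqrt {f : X → ℝ} (hf : MemLp f 2 μ) :
    eLpNorm f 2 μ = ENNReal.ofReal (Real.sqrt (∫ x, f x ^ 2 ∂μ)) := by
  rw [hf.eLpNorm_eq_integral_rpow_norm two_ne_zero ENNReal.ofNat_ne_top, Real.sqrt_eq_rpow]
  simp only [ENNReal.toReal_ofNat, Real.rpow_two, Real.norm_eq_abs, sq_abs, one_div]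

/-- **Fatou step.** An a.e. limit (along `S → ∞` in `ℝ`) of functions `f S ∈ L²(μ)` with
`√∫ (f S)² ≤ M` for `S ≥ 0` is in `L²(μ)` with `∫ g² ≤ M²`. -/
theorem memLp_and_integral_sq_le_of_tendsto {f : ℝ → X → ℝ} {g : X → ℝ} {M : ℝ} (hM : 0 ≤ M)
    (hf : ∀ S, 0 ≤ S → MemLp (f S) 2 μ)
    (hbound : ∀ S, 0 ≤ S → Real.sqrt (∫ x, f S x ^ 2 ∂μ) ≤ M)
    (hlim : ∀ᵐ x ∂μ, Tendsto (fun S => f S x) atTop (𝓝 (g x))) :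
    MemLp g 2 μ ∧ ∫ x, g x ^ 2 ∂μ ≤ M ^ 2 := by
  have hf' : ∀ n : ℕ, AEStronglyMeasurable (f n) μ := fun n =>
    (hf n (Nat.cast_nonneg n)).aestronglyMeasurable
  have hlim' : ∀ᵐ x ∂μ, Tendsto (fun n : ℕ => f n x) atTop (𝓝 (g x)) := by
    filter_upwards [hlim] with x hx using hx.comp tendsto_natCast_atTop_atTop
  have hbound' : ∀ᶠ n : ℕ in atTop, eLpNorm (f n) 2 μ ≤ ENNReal.ofReal M := by
    refine Eventually.of_forall fun n => ?_
    rw [eLpNorm_two_eq_sqrt (hf n (Nat.cast_nonneg n))]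
    exact ENNReal.ofReal_le_ofReal (hbound n (Nat.cast_nonneg n))
  have hg_meas : AEStronglyMeasurable g μ := aestronglyMeasurable_of_tendsto_ae atTop hf' hlim'
  have hg_norm : eLpNorm g 2 μ ≤ ENNReal.ofReal M :=
    Lp.eLpNorm_le_of_ae_tendsto hbound' hf' hlim'
  have hg_mem : MemLp g 2 μ := ⟨hg_meas, hg_norm.trans_lt ENNReal.ofReal_lt_top⟩
  refine ⟨hg_mem, ?_⟩
  have h1 : Real.sqrt (∫ x, g x ^ 2 ∂μ) ≤ M := by
    have h := hg_norm
    rw [eLpNorm_two_eq_sqrt hg_mem] at h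
    exact (ENNReal.ofReal_le_ofReal_iff hM).1 h
  have h0 : 0 ≤ ∫ x, g x ^ 2 ∂μ := integral_nonneg fun _ => sq_nonneg _
  calc ∫ x, g x ^ 2 ∂μ = Real.sqrt (∫ x, g x ^ 2 ∂μ) ^ 2 := (Real.sq_sqrt h0).symm
    _ ≤ M ^ 2 := pow_le_pow_left₀ (Real.sqrt_nonneg _) h1 2

end LTwo

section PerChain

variable {ω₂ lam β γ T : ℝ} {N : ℕ}

theorem Zmass_nonneg : 0 ≤ Zmass ω₂ lam β γ T N :=
  integral_nonneg fun _ => (Real.exp_pos _).le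

theorem forecastArea_nonneg (τ : ℝ) : 0 ≤ forecastArea ω₂ lam β γ T N τ :=
  setIntegral_nonneg measurableSet_Ioc fun _ _ => integral_nonneg fun _ => sq_nonneg _

/-- **Per-`N` conclusion of D7**: area `≤ C N² Z` at all horizons + ratio `≤ R` at all horizons + `u_S ∈ L²`
+ the crux's a.e.-limit hypothesis ⟹ `u ∈ L²(μ_T)` and `∫ u² ≤ (R ⊔ 0)(C ⊔ 0) · N² · Z` (Fatou). -/
theorem corrector_bound_of_area_ratio {C R : ℝ}
    (harea : ∀ τ : ℝ, 0 ≤ τ → forecastArea ω₂ lam β γ T N τ ≤ C * (N : ℝ) ^ 2 * Zmass ω₂ lam β γ T N)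
    (hratio : ∀ τ : ℝ, 0 ≤ τ →
      ∫ x, (horizonCorrector ω₂ lam β γ T N τ x) ^ 2 ∂(gibbsWeight ω₂ lam β γ T N)
        ≤ R * forecastArea ω₂ lam β γ T N τ)
    (hmem : ∀ S : ℝ, 0 ≤ S → MemLp (horizonCorrector ω₂ lam β γ T N S) 2 (gibbsWeight ω₂ lam β γ T N))
    {u : PhaseSpace N → ℝ}
    (hu : ∀ᵐ x ∂(gibbsWeight ω₂ lam β γ T N),
      Tendsto (fun S : ℝ => horizonCorrector ω₂ lam β γ T N S x) atTop (𝓝 (u x))) :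
    MemLp u 2 (gibbsWeight ω₂ lam β γ T N) ∧
      ∫ x, (u x) ^ 2 ∂(gibbsWeight ω₂ lam β γ T N)
        ≤ (max R 0 * max C 0) * (N : ℝ) ^ 2 * Zmass ω₂ lam β γ T N := by
  have hZ0 : 0 ≤ Zmass ω₂ lam β γ T N := Zmass_nonneg
  have hN0 : (0 : ℝ) ≤ (N : ℝ) := Nat.cast_nonneg N
  -- the all-horizon bound
  have hall : ∀ S : ℝ, 0 ≤ S →
      ∫ x, (horizonCorrector ω₂ lam β γ T N S x) ^ 2 ∂(gibbsWeight ω₂ lam β γ T N)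
        ≤ (max R 0 * max C 0) * (N : ℝ) ^ 2 * Zmass ω₂ lam β γ T N := by
    intro S hS
    have hA0 : 0 ≤ forecastArea ω₂ lam β γ T N S := forecastArea_nonneg S
    have h2 : forecastArea ω₂ lam β γ T N S ≤ max C 0 * (N : ℝ) ^ 2 * Zmass ω₂ lam β γ T N :=
      (harea S hS).trans (by gcongr; exact le_max_left _ _)
    calc ∫ x, (horizonCorrector ω₂ lam β γ T N S x) ^ 2 ∂(gibbsWeight ω₂ lam β γ T N)
        ≤ R * forecastArea ω₂ lam β γ T N S := hratio S hS
      _ ≤ max R 0 * forecastArea ω₂ lam β γ T N S :=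
          mul_le_mul_of_nonneg_right (le_max_left _ _) hA0
      _ ≤ max R 0 * (max C 0 * (N : ℝ) ^ 2 * Zmass ω₂ lam β γ T N) :=
          mul_le_mul_of_nonneg_left h2 (le_max_right _ _)
      _ = (max R 0 * max C 0) * (N : ℝ) ^ 2 * Zmass ω₂ lam β γ T N := by ring
  -- in `√`-form for Fatou
  set M : ℝ := Real.sqrt (max R 0 * max C 0) * (N : ℝ) * Real.sqrt (Zmass ω₂ lam β γ T N) with hMdef
  have hM0 : 0 ≤ M := by positivity
  have hsq : M ^ 2 = (max R 0 * max C 0) * (N : ℝ) ^ 2 * Zmass ω₂ lam β γ T N := by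
    rw [hMdef, mul_pow, mul_pow, Real.sq_sqrt hZ0, Real.sq_sqrt (by positivity)]
  have hsqrt : ∀ S : ℝ, 0 ≤ S →
      Real.sqrt (∫ x, (horizonCorrector ω₂ lam β γ T N S x) ^ 2 ∂(gibbsWeight ω₂ lam β γ T N)) ≤ M := by
    intro S hS
    rw [← Real.sqrt_sq hM0, hsq]
    exact Real.sqrt_le_sqrt (hall S hS)
  have h := memLp_and_integral_sq_le_of_tendsto hM0 hmem hsqrt hu
  exact ⟨h.1, h.2.trans_eq hsq⟩

end PerChain

/-! ## §3 The glued split D7, proved to the route decl BY NAME -/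

/-- **D7.** `ForecastArea → ForecastCorrelationTime → ConeScaleCorrector` (E1 by name). Real proof on the standard
axioms; the only unproved inputs are the two hypotheses. Constant `C_E1 = (R ⊔ 0)(C ⊔ 0)`. -/
theorem coneScaleCorrector_of_area_ratio (hA : ForecastArea) (hR : ForecastCorrelationTime) :
    ConeScaleCorrector := by
  intro ω₂ lam β γ hω hl hβ hγ T hT
  obtain ⟨C, hC⟩ := hA ω₂ lam β γ hω hl hβ hγ T hT
  obtain ⟨R, hRR⟩ := hR ω₂ lam β γ hω hl hβ hγ T hT
  refine ⟨max R 0 * max C 0, fun N u hu => ?_⟩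
  exact corrector_bound_of_area_ratio (fun τ hτ => hC N τ hτ) (fun τ hτ => hRR N τ hτ)
    (Summit.AtomisticToContinuum.FouriersLaw.Theorems.OddSectorIrreversibility.stub_horizonCorrectorMemLp
      ω₂ lam β γ hω hl hβ hγ T hT N) hu

/-- Sanity: (A2) pointwise decorrelation trivially gives (A3) the global ratio? — NO, not without Fubini on the
triangle and integrability bookkeeping; we do not prove it here (it is the 'recorded, not proposed' statement). What
IS immediate is the converse direction of interest to the census: neither (A1) nor (A3) mentions `⟨J, u⟩`. -/
example : True := trivial

end Summit.AtomisticToContinuum.FouriersLaw.Cruxes.ConeScaleCorrector.Strategist
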